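import Mathlib
import HarnessLib
import Summits.RiemannHypothesis.RiemannHypothesis.Theorems.IntegerScrewSmoothSectorDefs

/-!
# Route `ScrewLemmaKCoprofile` — calculus of an admissible generator on `[0,1]` (toolkit T0 for
# K2 `CoprofileMoments`, stmt-RiemannHypothesis-21613)

For `g : ℝ → ℝ` with `ContDiffOn ℝ 1 g (Icc 0 1)` (first clause of
`…Theorems.IntegerScrew.SmoothSectorAdmissible`): `deriv g` is the genuine derivative on `(0,1)`,
it is bounded there (and on `(0,1]`), integrable on `[0,1]`, the FTC `∫₀¹ g′ = g(1) − g(0)` holds,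
and the one-sided integration by parts against `u^a` (`a > 0`, so that `a = 1/2` is allowed)
`∫₀¹ g′(u)u^a du = g(1) − ∫₀¹ a u^{a−1} g(u) du`.  For an ADMISSIBLE generator (`g(1) = 0`,
`∫₀¹ g = 0`, `∫₀¹ g(u)u^{−1/2} du = 0`) this gives the three GENERATOR MOMENTS that K2 consumes:

* `integral_deriv_eq_neg_apply_zero` : `∫₀¹ g′ = −g(0)` (`= 2h₀`, `h₀ = latticePlateau g`);
* `integral_deriv_mul_sqrt_eq_zero` : `∫₀¹ g′(u) u^{1/2} du = 0`;
* `integral_deriv_mul_id_eq_zero`   : `∫₀¹ g′(u) u du = 0`.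

Adapted from the rh-idea-5 desk toolkit `CoprofileMellin.lean` (evidence on item 21613).
Mathlib only (FTC / IBP with one-sided derivatives).  RH-free; nothing here bears on the truth
of RH.
-/

noncomputable section

set_option linter.dupNamespace false

namespace Summit.RiemannHypothesis.RiemannHypothesis.Theorems.ScrewLemmaKCoprofile

open MeasureTheory Set Filter
open Summit.RiemannHypothesis.RiemannHypothesis.Theorems.IntegerScrew (SmoothSectorAdmissible)

/-- At an interior point of `[0,1]`, a `C¹`-on-`[0,1]` function has derivative `deriv g x`.
[folklore] -/
theorem hasDerivAt_of_contDiffOn_Icc {g : ℝ → ℝ} (hg : ContDiffOn ℝ 1 g (Set.Icc 0 1)) {x : ℝ}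
    (hx : x ∈ Set.Ioo (0:ℝ) 1) : HasDerivAt g (deriv g x) x := by
  have hd : DifferentiableOn ℝ g (Set.Icc 0 1) := hg.differentiableOn one_ne_zero
  exact ((hd x (Set.Ioo_subset_Icc_self hx)).differentiableAt (Icc_mem_nhds hx.1 hx.2)).hasDerivAt

/-- On the interior, the one-sided (`Icc`) derivative is the derivative. [folklore] -/
theorem derivWithin_Icc_eq_deriv {g : ℝ → ℝ} {x : ℝ} (hx : x ∈ Set.Ioo (0:ℝ) 1) :
    derivWithin g (Set.Icc 0 1) x = deriv g x :=
  derivWithin_of_mem_nhds (Icc_mem_nhds hx.1 hx.2)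

/-- The `Icc`-derivative of a `C¹`-on-`[0,1]` function is continuous on `[0,1]`. [folklore] -/
theorem continuousOn_derivWithin_Icc_of_contDiffOn {g : ℝ → ℝ}
    (hg : ContDiffOn ℝ 1 g (Set.Icc 0 1)) :
    ContinuousOn (derivWithin g (Set.Icc 0 1)) (Set.Icc 0 1) :=
  hg.continuousOn_derivWithin (uniqueDiffOn_Icc zero_lt_one) le_rfl

/-- T0b: `g′` is bounded on `(0,1)`. [folklore] -/
theorem exists_bound_deriv_Ioo {g : ℝ → ℝ} (hg : ContDiffOn ℝ 1 g (Set.Icc 0 1)) :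
    ∃ B, ∀ u ∈ Set.Ioo (0:ℝ) 1, |deriv g u| ≤ B := by
  obtain ⟨B, hB⟩ :=
    isCompact_Icc.exists_bound_of_continuousOn (continuousOn_derivWithin_Icc_of_contDiffOn hg)
  refine ⟨B, fun u hu => ?_⟩
  have h := hB u (Set.Ioo_subset_Icc_self hu)
  rwa [derivWithin_Icc_eq_deriv hu, Real.norm_eq_abs] at h

/-- T0b′: `deriv g` is bounded by a NONNEGATIVE constant on `(0,1]` (at `u = 1` the value
`deriv g 1` is whatever Mathlib's `deriv` returns; it is one more number to dominate).
[folklore] -/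
theorem exists_bound_deriv_Ioc {g : ℝ → ℝ} (hg : ContDiffOn ℝ 1 g (Set.Icc 0 1)) :
    ∃ B, 0 ≤ B ∧ ∀ u ∈ Set.Ioc (0:ℝ) 1, |deriv g u| ≤ B := by
  obtain ⟨B, hB⟩ := exists_bound_deriv_Ioo hg
  refine ⟨max (max B 0) |deriv g 1|, le_trans (le_max_right B 0) (le_max_left _ _), fun u hu => ?_⟩
  rcases eq_or_lt_of_le hu.2 with h | h
  · rw [h]; exact le_max_right _ _
  · exact le_trans (hB u ⟨hu.1, h⟩) (le_trans (le_max_left B 0) (le_max_left _ _))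

/-- T0c: `g′` is integrable on `[0,1]`. [folklore] -/
theorem intervalIntegrable_deriv_of_contDiffOn {g : ℝ → ℝ}
    (hg : ContDiffOn ℝ 1 g (Set.Icc 0 1)) : IntervalIntegrable (deriv g) volume 0 1 := by
  have h1 : IntegrableOn (derivWithin g (Set.Icc 0 1)) (Set.Icc 0 1) :=
    (continuousOn_derivWithin_Icc_of_contDiffOn hg).integrableOn_compact isCompact_Icc
  rw [intervalIntegrable_iff_integrableOn_Ioo_of_le zero_le_one]
  exact (h1.mono_set Set.Ioo_subset_Icc_self).congr_fun
    (fun x hx => derivWithin_Icc_eq_deriv hx) measurableSet_Ioo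

/-- FTC: `∫₀¹ g′ = g(1) − g(0)`. [folklore] -/
theorem integral_deriv_eq_sub {g : ℝ → ℝ} (hg : ContDiffOn ℝ 1 g (Set.Icc 0 1)) :
    ∫ u in (0:ℝ)..1, deriv g u = g 1 - g 0 :=
  intervalIntegral.integral_eq_sub_of_hasDeriv_right_of_le zero_le_one hg.continuousOn
    (fun _ hx => (hasDerivAt_of_contDiffOn_Icc hg hx).hasDerivWithinAt)
    (intervalIntegrable_deriv_of_contDiffOn hg)

/-- IBP against `u^a` (`a > 0`), with one-sided derivatives so that `a = 1/2` is allowed: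
`∫₀¹ g′(u) u^a du = g(1) − ∫₀¹ a u^{a−1} g(u) du`. [folklore] -/
theorem integral_deriv_mul_rpow_eq {g : ℝ → ℝ} (hg : ContDiffOn ℝ 1 g (Set.Icc 0 1)) {a : ℝ}
    (ha : 0 < a) :
    ∫ u in (0:ℝ)..1, deriv g u * u ^ a = g 1 - ∫ u in (0:ℝ)..1, a * u ^ (a - 1) * g u := by
  have hu : ContinuousOn (fun x : ℝ => x ^ a) (Set.uIcc 0 1) :=
    (Real.continuous_rpow_const ha.le).continuousOn
  have hv : ContinuousOn g (Set.uIcc 0 1) := by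
    rw [Set.uIcc_of_le zero_le_one]; exact hg.continuousOn
  have huu' : ∀ x ∈ Set.Ioo (min 0 1 : ℝ) (max 0 1),
      HasDerivWithinAt (fun x : ℝ => x ^ a) (a * x ^ (a - 1)) (Set.Ioi x) x := by
    intro x hx
    rw [min_eq_left zero_le_one, max_eq_right zero_le_one] at hx
    exact (Real.hasDerivAt_rpow_const (Or.inl hx.1.ne')).hasDerivWithinAt
  have hvv' : ∀ x ∈ Set.Ioo (min 0 1 : ℝ) (max 0 1),
      HasDerivWithinAt g (deriv g x) (Set.Ioi x) x := by
    intro x hx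
    rw [min_eq_left zero_le_one, max_eq_right zero_le_one] at hx
    exact (hasDerivAt_of_contDiffOn_Icc hg hx).hasDerivWithinAt
  have hu' : IntervalIntegrable (fun x : ℝ => a * x ^ (a - 1)) volume 0 1 :=
    (intervalIntegral.intervalIntegrable_rpow' (by linarith)).const_mul a
  have h := intervalIntegral.integral_mul_deriv_eq_deriv_mul_of_hasDeriv_right hu hv huu' hvv'
    hu' (intervalIntegrable_deriv_of_contDiffOn hg)
  have e : (∫ u in (0:ℝ)..1, deriv g u * u ^ a) = ∫ u in (0:ℝ)..1, u ^ a * deriv g u :=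
    intervalIntegral.integral_congr fun u _ => by ring
  rw [e, h, Real.one_rpow, Real.zero_rpow ha.ne']
  ring

/-- `∫₀¹ g′(u) u du = 0` for an admissible generator (`g(1) = 0`, `∫₀¹ g = 0`). [folklore] -/
theorem integral_deriv_mul_id_eq_zero {g : ℝ → ℝ} (hg : SmoothSectorAdmissible g) :
    ∫ u in (0:ℝ)..1, deriv g u * u = 0 := by
  obtain ⟨hC, h1, hI, _⟩ := hg
  have h := integral_deriv_mul_rpow_eq hC one_pos
  simp only [Real.rpow_one] at h
  rw [h, h1]
  have e : (∫ u in (0:ℝ)..1, (1:ℝ) * u ^ ((1:ℝ) - 1) * g u) = ∫ u in (0:ℝ)..1, g u :=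
    intervalIntegral.integral_congr fun u _ => by simp
  rw [e, hI]; simp

/-- `∫₀¹ g′(u) u^{1/2} du = 0` for an admissible generator (`g(1) = 0`, `∫₀¹ g u^{−1/2} = 0`).
[folklore] -/
theorem integral_deriv_mul_sqrt_eq_zero {g : ℝ → ℝ} (hg : SmoothSectorAdmissible g) :
    ∫ u in (0:ℝ)..1, deriv g u * u ^ (1 / 2 : ℝ) = 0 := by
  obtain ⟨hC, h1, _, hJ⟩ := hg
  rw [integral_deriv_mul_rpow_eq hC (by norm_num : (0:ℝ) < 1 / 2), h1]
  have e : (∫ u in (0:ℝ)..1, (1 / 2 : ℝ) * u ^ ((1 / 2 : ℝ) - 1) * g u)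
      = (1 / 2 : ℝ) * ∫ u in (0:ℝ)..1, g u * u ^ (-(1 / 2 : ℝ)) := by
    rw [← intervalIntegral.integral_const_mul]
    refine intervalIntegral.integral_congr fun u _ => ?_
    rw [show (1 / 2 : ℝ) - 1 = -(1 / 2 : ℝ) by norm_num]
    ring
  rw [e, hJ]; simp

/-- `∫₀¹ g′ = −g(0)` for an admissible generator (`g(1) = 0`). [folklore] -/
theorem integral_deriv_eq_neg_apply_zero {g : ℝ → ℝ} (hg : SmoothSectorAdmissible g) :
    ∫ u in (0:ℝ)..1, deriv g u = -(g 0) := by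
  rw [integral_deriv_eq_sub hg.1, hg.2.1]; ring

end Summit.RiemannHypothesis.RiemannHypothesis.Theorems.ScrewLemmaKCoprofile

end
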